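import Summits.NavierStokesRegularity.NavierStokesRegularity.Theorems.FilamentSkeletonRssBoxSelectionRJ
import Summits.NavierStokesRegularity.NavierStokesRegularity.Theorems.FilamentSkeletonRssSkeletonJ1GSplit

/-!
# RETYPE KIT «A1L» (rigid matched cores) for route `FilamentSkeletonRss` — crux workfile of `SelectionBoxRJ`
# (stmt-NavierStokesRegularity-21220), author ns-idea-12 g6 (planner; files only; 0 kit). Companion of the crux idea
# `Ideas/la-rigid-core.md` (v3 eb1810ede84f) and of `Lines/la_rigid_core_sketch.lean` (57b83113af45).

WHAT. Variant A1L = the route's live pair `SkeletonJ1G` (27849) / `TransverseReduction1AG` (27853) with exactly ONE conjunct swapped,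
in lock-step in both decls (binders, constants and every other clause VERBATIM, so the split children 28295–28297, the glue 28298, the
proved `Selection1AG` pattern and the route's `closes` re-thread mechanically):
  OLD  `(∀ j, Differentiable ℝ (Aa j) ∧ (∀ τ, 0 < Aa j τ) ∧ ∀ τ, w j τ*deriv (Aa j) τ = (3/2-deriv (w j) τ)*Aa j τ+4)`      — passive core-area LAW
  NEW  `(∀ j, Differentiable ℝ (Aa j) ∧ (∀ τ, 0 < Aa j τ) ∧ 1≤KA*Aa j (c j) ∧ ∀ τ, ‖X j τ‖≤2*Rb*√(Γ*Real.log Γ) → Aa j τ = Aa j (c j))`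
       — RIGID matched core area on the doubled tangency ball (the only region where the kernel radius enters at leading order: the
       self-induction in the tangency clause), floor `1/KA ≤ Aa j (c j)`; the Γ-flat cone bound `Rw^2*Γ*Aa j τ≤KA*(Rw^2*Γ+‖X j τ‖^2)`
       is KEPT verbatim (so `1/KA ≤ Aa j (c j) ≤ KA·(1+‖X j (c j)‖²/(Rw²Γ)) ≤ 2KA`), the waist clause `3/2+δ≤deriv (w j) (c j)≤Λ` is KEPT
       (it feeds clause 12 / the hyperbolic normal block, `clause12_of_skeleton` p599125 — not the area law).
WHY (physics, one paragraph; details and numbers in the idea card, derivation D1–D8): at the route's circulations the on-axis axial momentum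
balance of a slender strongly swirling core, `W W′ = w w′ + kG²(1/A)′ − c_ν(W−w)/A` with `kG² ≈ 0.23Γ² ≫` the O(Γ) ambient heads, makes the
exact profile's matched core areas constant to `|ΔA|/A ≲ 10·A·‖X‖²/Γ²` (→ 0 on the doubled tangency ball) and puts the stretching mismatch into a
CONFINED axial jet inside the tube, which the skeleton field outside the tubes does not see at leading order; the passive law (OLD) instead
transports the area with the ambient slip and predicts cone-fattening cores (`Aa ×3.4` at the tangency-ball edge, `×11` at 3√Γ, Γ = 1e5),
i.e. kernel radii the true object does not have.  The swap makes the ∃-side (28295: near-straight continuation; KILL-1 «fat + arm» of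
j306611 is a passive-clause artefact — μ_j constant decouples R–μ) easier and the ∀-side (27853 L3 stub S1 `FamilyDressing1AG`) physically
consistent; `CoreAreaNecessity` (15404) stays true but is no longer invoked (the waist–area link `Aa(c) = 4/(w′(c) − 3/2)` is dropped).
WHAT A SKELETON PROVER DOES UNDER A1L: take `Aa j ≡ A₀` (constant everywhere is admissible: the cone bound then reads `A₀ ≤ KA`), e.g. the
landed R_π datum with `A₀ = 16` (continuity with j306611) or any `1/KA ≤ A₀ ≤ KA`; the stepping stones `FilamentSkeletonRssStraightAreaLaw`
(27592) become unnecessary but stay true.  WHAT THE TENURE DOES: `route edit` restating 27849/27853 (and re-threading 28295–28298) with the NEW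
conjunct; this file CERTIFIES that the A1L pair elaborates, that the selection glue is PROVED verbatim (`selection1AL_proof`, the rev-43 pattern),
and that `closes1AL : SkeletonJ1L → TransverseReduction1AL → RdssProfileTruncation → ¬NavierStokesRegularity` elaborates sorry-free.
MODEL rung, NEGATIVE side (hypothetical blow-up profile); nothing here bears on NS regularity (OPEN); both new decls are open cruxes exactly as
27849/27853 are; no summit is proved by a kit.
-/

set_option linter.dupNamespace false
set_option linter.unusedVariables false

noncomputable section

namespace Summit.NavierStokesRegularity.NavierStokesRegularity.Cruxes.SelectionBoxRJ.RetypeKitA1L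

open Set Function Filter MeasureTheory Real
open Literature.Analysis.FluidPDE Literature.Analysis.FluidPDE.PineauVicol2026
open Summit.NavierStokesRegularity.NavierStokesRegularity.Theses.FilamentSkeletonRss
open Summit.NavierStokesRegularity.NavierStokesRegularity.Theorems
open scoped InnerProductSpace Laplacian ContDiff Topology BigOperators

/-! ## VARIANT A1L (2026-08-28, ns-idea-12 g6) — A1G with RIGID matched cores (la-rigid-core) -/

/-- crux (rank 2, Variant A1L): SkeletonJ1G with the passive core-area LAW replaced by RIGID (constant) matched core areas on the doubled tangency ball (la-rigid-core); same binders, same constants. -/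
def SkeletonJ1L : Prop :=
(open Literature.Analysis.FluidPDE in ∃ (N:ℕ) (δ ρ K Λ a b cnd η Rw Rb cg θ₀ KA Γ₂:ℝ), 0 < N ∧ 0 < δ ∧ 0 < ρ ∧ 0 ≤ a ∧ 0 < cnd ∧ 0 < η ∧ 0 < Rw ∧ 0 < Rb ∧ 0 < cg ∧ 0 < θ₀ ∧ ∀ Γ:ℝ, Γ₂≤Γ → ∃ (γ:Fin N → ℝ) (α:ℝ) (X:Fin N → ℝ → EuclideanSpace ℝ (Fin 3)) (w:Fin N → ℝ → ℝ) (c:Fin N → ℝ) (m n:Fin N → EuclideanSpace ℝ (Fin 3)) (Aa:Fin N → ℝ → ℝ), ∀ (u:(Fin N → ℝ → EuclideanSpace ℝ (Fin 3)) → EuclideanSpace ℝ (Fin 3) → EuclideanSpace ℝ (Fin 3)) (v:EuclideanSpace ℝ (Fin 3) → EuclideanSpace ℝ (Fin 3)) (A:Fin N → (EuclideanSpace ℝ (Fin 3) →L[ℝ] EuclideanSpace ℝ (Fin 3))) (T:(Fin N → ℝ → EuclideanSpace ℝ (Fin 3)) → Fin N → ℝ → EuclideanSpace ℝ (Fin 3)),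 (∀ Z y, u Z y = ∑ k, (Γ*γ k/(4*Real.pi))•∫ σ:ℝ, ((‖y-Z k σ‖^2+Real.exp (-(1+Real.eulerMascheroniConstant-Real.log 2))*Aa k σ)^(3/2:ℝ))⁻¹•cross (deriv (Z k) σ) (y-Z k σ))→(∀ y, v y = u X y+(1/2:ℝ)•y-α•cross (EuclideanSpace.single 2 1) y)→(∀ j, A j = fderiv ℝ v (X j (c j)))→(∀ Z j τ, T Z j τ = (u Z (Z j τ)+(1/2:ℝ)•Z j τ-α•cross (EuclideanSpace.single 2 1) (Z j τ))-(⟪u Z (Z j τ)+(1/2:ℝ)•Z j τ-α•cross (EuclideanSpace.single 2 1) (Z j τ), deriv (Z j) τ⟫_ℝ/‖deriv (Z j) τ‖^2)•deriv (Z j) τ)→((α ≠ 0 ∧ (∀ j, γ j ≠ 0)∧(∀ j, ContDiff ℝ 2 (X j) ∧ Differentiable ℝ (w j)∧(∀ τ, ‖deriv (X j) τ‖ = 1)∧(∀ τ, ‖iteratedDeriv 2 (X j) τ‖*√Γ≤K) ∧ Tendsto (fun τ => ‖X j τ‖) (cocompact ℝ) atTop)∧(∀ j k, j ≠ k → ∀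 τ σ, ρ*√Γ≤‖X j τ-X k σ‖)∧(∀ j τ σ, ρ*√Γ≤|τ-σ| → cg*ρ*√Γ≤‖X j τ-X j σ‖)∧(∀ j τ, cg*|τ-c j|≤Rw*√Γ+‖X j τ‖)∧(∀ j τ, w j τ = ⟪v (X j τ), deriv (X j) τ⟫_ℝ)∧(∀ j τ, ‖X j τ‖≤Rb*√(Γ*Real.log Γ) → v (X j τ) = w j τ•deriv (X j) τ)∧(∀ j, ‖X j (c j)‖≤Rw*√Γ)∧(∀ j, |⟪deriv (X j) (c j), EuclideanSpace.single 2 1⟫_ℝ|≤1-θ₀)∧(θ₀≤|α| ∧ |α|≤θ₀⁻¹ ∧ ∀ j, θ₀≤|γ j| ∧ |γ j|≤θ₀⁻¹)∧(∀ j, w j (c j) = 0 ∧ (∀ τ, w j τ = 0 → τ = c j) ∧ 3/2+δ≤deriv (w j) (c j) ∧ deriv (w j) (c j)≤Λ)∧(∀ j, Differentiable ℝ (Aa j) ∧ (∀ τ, 0 < Aa j τ) ∧ 1≤KA*Aa j (c j) ∧ ∀ τ, ‖X j τ‖≤2*Rb*√(Γ*Real.log Γ) → Aa j τ = Aa j (c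 j))∧(∀ j τ, Rw^2*Γ*Aa j τ≤KA*(Rw^2*Γ+‖X j τ‖^2))∧(∀ j, Orthonormal ℝ ![deriv (X j) (c j), m j, n j] ∧ ⟪A j (m j), m j⟫_ℝ+⟪A j (n j), n j⟫_ℝ < 0 ∧ ⟪A j (n j), m j⟫_ℝ * ⟪A j (m j), n j⟫_ℝ < ⟪A j (m j), m j⟫_ℝ * ⟪A j (n j), n j⟫_ℝ)∧(∀ Y:Fin N → ℝ → EuclideanSpace ℝ (Fin 3), (∀ j, ContDiff ℝ 2 (Y j))→(∀ j τ, ⟪Y j τ, deriv (X j) τ⟫_ℝ = 0) → (∀ j τ, Rb*√(Γ*Real.log Γ) < ‖X j τ‖ → Y j τ = 0) → ∑ j, ⟪Y j (c j), cross (EuclideanSpace.single 2 1) (X j (c j))⟫_ℝ = 0 → (∀ j τ, ‖Y j τ‖+‖deriv (Y j) τ‖+‖iteratedDeriv 2 (Y j) τ‖≤(1+|τ-c j|)^b) → ∀ L:ℝ, (∀ j τ, ‖deriv (fun s:ℝ => T (fun k σ => X k σ+s•Y k σ) j τ) 0‖≤L*(1+|τ-c j|)^a) → ∀ j τ, ‖Y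 j τ‖≤cnd*L*(1+|τ-c j|)^b))))

/-- crux (rank 3, Variant A1L): TransverseReduction1AG with the same clause swap among the skeleton hypotheses (lock-step). -/
def TransverseReduction1AL : Prop :=
(open Literature.Analysis.FluidPDE in ∀ (N:ℕ) (δ ρ K Λ a b cnd η Rw Rb cg θ₀ KA:ℝ), 0 < N → 0 < δ → 0 < ρ → 0 ≤ a → 0 < η → 0 < Rw → 0 < Rb → 0 < cg → 0 < θ₀ → ∃ Γ₁:ℝ, ∀ Γ:ℝ, Γ₁≤Γ → ∀ (γ:Fin N → ℝ) (α:ℝ) (X:Fin N → ℝ → EuclideanSpace ℝ (Fin 3)) (w:Fin N → ℝ → ℝ) (c:Fin N → ℝ) (m n:Fin N → EuclideanSpace ℝ (Fin 3)) (Aa:Fin N → ℝ → ℝ) (u:(Fin N → ℝ → EuclideanSpace ℝ (Fin 3)) → EuclideanSpace ℝ (Fin 3) → EuclideanSpace ℝ (Fin 3)) (v:EuclideanSpace ℝ (Fin 3) → EuclideanSpace ℝ (Fin 3)) (A:Fin N → (EuclideanSpace ℝ (Fin 3) →L[ℝ] EuclideanSpace ℝ (Fin 3))) (T:(Fin N →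 ℝ → EuclideanSpace ℝ (Fin 3)) → Fin N → ℝ → EuclideanSpace ℝ (Fin 3)), (∀ Z y, u Z y = ∑ k, (Γ*γ k/(4*Real.pi))•∫ σ:ℝ, ((‖y-Z k σ‖^2+Real.exp (-(1+Real.eulerMascheroniConstant-Real.log 2))*Aa k σ)^(3/2:ℝ))⁻¹•cross (deriv (Z k) σ) (y-Z k σ))→(∀ y, v y = u X y+(1/2:ℝ)•y-α•cross (EuclideanSpace.single 2 1) y)→(∀ j, A j = fderiv ℝ v (X j (c j)))→(∀ Z j τ, T Z j τ = (u Z (Z j τ)+(1/2:ℝ)•Z j τ-α•cross (EuclideanSpace.single 2 1) (Z j τ))-(⟪u Z (Z j τ)+(1/2:ℝ)•Z j τ-α•cross (EuclideanSpace.single 2 1) (Z j τ), deriv (Z j) τ⟫_ℝ/‖deriv (Z j) τ‖^2)•deriv (Z j) τ)→((α ≠ 0 ∧ (∀ j, γ j ≠ 0)∧(∀ j, ContDiff ℝ 2 (X j) ∧ Differentiable ℝ (w j)∧(∀ τ, ‖deriv (X j) τ‖ = 1)∧(∀ τ, ‖iteratedDeriv 2 (X j) τ‖*√Γ≤K) ∧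 Tendsto (fun τ => ‖X j τ‖) (cocompact ℝ) atTop)∧(∀ j k, j ≠ k → ∀ τ σ, ρ*√Γ≤‖X j τ-X k σ‖)∧(∀ j τ σ, ρ*√Γ≤|τ-σ| → cg*ρ*√Γ≤‖X j τ-X j σ‖)∧(∀ j τ, cg*|τ-c j|≤Rw*√Γ+‖X j τ‖)∧(∀ j τ, w j τ = ⟪v (X j τ), deriv (X j) τ⟫_ℝ)∧(∀ j τ, ‖X j τ‖≤Rb*√(Γ*Real.log Γ) → v (X j τ) = w j τ•deriv (X j) τ)∧(∀ j, ‖X j (c j)‖≤Rw*√Γ)∧(∀ j, |⟪deriv (X j) (c j), EuclideanSpace.single 2 1⟫_ℝ|≤1-θ₀)∧(θ₀≤|α| ∧ |α|≤θ₀⁻¹ ∧ ∀ j, θ₀≤|γ j| ∧ |γ j|≤θ₀⁻¹)∧(∀ j, w j (c j) = 0 ∧ (∀ τ, w j τ = 0 → τ = c j) ∧ 3/2+δ≤deriv (w j) (c j) ∧ deriv (w j) (c j)≤Λ)∧(∀ j, Differentiable ℝ (Aa j) ∧ (∀ τ, 0 < Aa j τ) ∧ 1≤KA*Aa j (c j)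 ∧ ∀ τ, ‖X j τ‖≤2*Rb*√(Γ*Real.log Γ) → Aa j τ = Aa j (c j))∧(∀ j τ, Rw^2*Γ*Aa j τ≤KA*(Rw^2*Γ+‖X j τ‖^2))∧(∀ j, Orthonormal ℝ ![deriv (X j) (c j), m j, n j] ∧ ⟪A j (m j), m j⟫_ℝ+⟪A j (n j), n j⟫_ℝ < 0 ∧ ⟪A j (n j), m j⟫_ℝ * ⟪A j (m j), n j⟫_ℝ < ⟪A j (m j), m j⟫_ℝ * ⟪A j (n j), n j⟫_ℝ)∧(∀ Y:Fin N → ℝ → EuclideanSpace ℝ (Fin 3), (∀ j, ContDiff ℝ 2 (Y j))→(∀ j τ, ⟪Y j τ, deriv (X j) τ⟫_ℝ = 0) → (∀ j τ, Rb*√(Γ*Real.log Γ) < ‖X j τ‖ → Y j τ = 0) → ∑ j, ⟪Y j (c j), cross (EuclideanSpace.single 2 1) (X j (c j))⟫_ℝ = 0 → (∀ j τ, ‖Y j τ‖+‖deriv (Y j) τ‖+‖iteratedDeriv 2 (Y j) τ‖≤(1+|τ-c j|)^b) → ∀ L:ℝ, (∀ j τ, ‖deriv (fun s:ℝ => T (fun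 k σ => X k σ+s•Y k σ) j τ) 0‖≤L*(1+|τ-c j|)^a) → ∀ j τ, ‖Y j τ‖≤cnd*L*(1+|τ-c j|)^b))) → ∃ (α₁ C₀ M:ℝ) (U:EuclideanSpace ℝ (Fin 3) → EuclideanSpace ℝ (Fin 3)) (P:EuclideanSpace ℝ (Fin 3) → ℝ), (α₁ ≠ 0 ∧ U ≠ 0 ∧ ContDiff ℝ (⊤:ℕ∞) U ∧ ContDiff ℝ (⊤:ℕ∞) P ∧ VectorCalculus.IsDivFree U∧(∀ y, α₁•(cross (EuclideanSpace.single 2 1) (U y)-fderiv ℝ U y (cross (EuclideanSpace.single 2 1) y))+(1/2:ℝ)•U y+(1/2:ℝ)•fderiv ℝ U y y-(Laplacian.laplacian U) y+fderiv ℝ U y (U y)+gradient P y = 0)∧(∀ y, ‖U y‖≤C₀/(1+‖y‖))∧(∀ y, |P y|≤M)∧(∀ y, ‖y‖≤Rw*√Γ → (∀ j τ, ρ*√Γ/4≤‖y-X j τ‖) → ‖U y-u X y‖≤η*√Γ)))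

/-- glue (provable now, Variant A1L). -/
def Selection1AL : Prop :=
  SkeletonJ1L → TransverseReduction1AL → RssProfileExists

theorem selection1AL_proof : Selection1AL := by
  unfold Selection1AL
  intro hbox hred
  classical
  obtain ⟨N, δ, ρ, K, Λ, a, b, cnd, η, Rw, Rb, cg, θ₀, KA, Γ₂, hN, hδ, hρ, ha, _hcnd, hη, hRw, hRb, hcg, hθ₀, hbox⟩ :=
    hbox
  obtain ⟨Γ₁, hred⟩ := hred N δ ρ K Λ a b cnd η Rw Rb cg θ₀ KA hN hδ hρ ha hη hRw hRb hcg hθ₀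
  obtain ⟨γ, α, X, w, c, m, n, Aa, hfam⟩ := hbox (max Γ₁ Γ₂) (le_max_right _ _)
  set Γ : ℝ := max Γ₁ Γ₂
  set u : (Fin N → ℝ → EuclideanSpace ℝ (Fin 3)) → EuclideanSpace ℝ (Fin 3) → EuclideanSpace ℝ (Fin 3) :=
    fun Z y => ∑ k : Fin N, (Γ * γ k / (4 * π)) • ∫ σ : ℝ,
        ((‖y - Z k σ‖ ^ 2 + Real.exp (-(1 + Real.eulerMascheroniConstant - Real.log 2)) * Aa k σ) ^ (3 / 2 : ℝ))⁻¹ •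
          cross (deriv (Z k) σ) (y - Z k σ)
  set v : EuclideanSpace ℝ (Fin 3) → EuclideanSpace ℝ (Fin 3) :=
    fun y => u X y + (1 / 2 : ℝ) • y - α • cross (EuclideanSpace.single (2 : Fin 3) (1 : ℝ)) y
  set A : Fin N → (EuclideanSpace ℝ (Fin 3) →L[ℝ] EuclideanSpace ℝ (Fin 3)) := fun j => fderiv ℝ v (X j (c j))
  set T : (Fin N → ℝ → EuclideanSpace ℝ (Fin 3)) → Fin N → ℝ → EuclideanSpace ℝ (Fin 3) :=
    fun Z j τ => (u Z (Z j τ) + (1 / 2 : ℝ) • Z j τ - α • cross (EuclideanSpace.single (2 : Fin 3) (1 : ℝ)) (Z j τ)) -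
      (inner ℝ (u Z (Z j τ) + (1 / 2 : ℝ) • Z j τ - α • cross (EuclideanSpace.single (2 : Fin 3) (1 : ℝ)) (Z j τ)) (deriv (Z j) τ) /
        ‖deriv (Z j) τ‖ ^ 2) • deriv (Z j) τ
  have hskel := hfam u v A T (fun _ _ => rfl) (fun _ => rfl) (fun _ => rfl) (fun _ _ _ => rfl)
  obtain ⟨α₁, C₀, M, U, P, hα₁, hU0, hUs, hPs, hdiv, heq, hdec, hPM, -⟩ := hred Γ (le_max_left _ _) γ α X w c m n Aa u v A T
    (fun _ _ => rfl) (fun _ => rfl) (fun _ => rfl) (fun _ _ _ => rfl) hskel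
  have heq0 : ∀ y : EuclideanSpace ℝ (Fin 3), α₁ • (rotGen (U y) - fderiv ℝ U y (rotGen y)) +
      (1 / 2 : ℝ) • U y + (1 / 2 : ℝ) • fderiv ℝ U y y - (Δ U) y + fderiv ℝ U y (U y) + gradient P y = 0 := by
    intro y
    simp only [splitGlue_rotGen_eq_cross_single_two]
    exact heq y
  exact stub_rssProfileExists_of_profile ⟨α₁, C₀, M, U, P, hα₁, hU0, hUs, hPs, hdiv, heq0, hdec, hPM⟩

theorem closes1AL (hSk : SkeletonJ1L) (hTR : TransverseReduction1AL) (hT : RdssProfileTruncation) :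
    ¬ _root_.NavierStokesRegularity := by
  obtain ⟨α, C₀, U, Rot, u, -, -, hU2, hU0, hu1, hrss, hmild, hmeas, hC⟩ := selection1AL_proof hSk hTR
  have hrdss : Literature.Analysis.FluidPDE.IsRotatedDSS 2 (Rot (-(α * (2 * Real.log 2)))) u := hrss 2 two_pos
  have hnz : ¬ (∀ t < 0, u t =ᵐ[volume] 0) := by
    intro h
    have h1 := h (-1) (by norm_num)
    rw [hu1] at h1
    exact hU0 ((Continuous.ae_eq_iff_eq volume hU2.continuous continuous_const).1 h1)
  obtain ⟨ν, hν, T, hT, v, q, ⟨hcl, hmax⟩, hLH, hdec⟩ := hT ⟨2, _, _, one_lt_two, hmild, hmeas, hrdss, ⟨C₀, hC⟩, hnz⟩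
  intro hA
  have h0 : (0 : ℝ) ∈ Set.Ico 0 T := ⟨le_rfl, hT⟩
  obtain ⟨u', p', hu', hp', hns, hbe⟩ := hA ν hν (v 0) (hcl.contDiff_velocity h0) (hcl.divFree 0 h0) hdec
  have heq : ∀ t ∈ Set.Ico 0 T, u' t = v t :=
    _root_.Summit.NavierStokesRegularity.NavierStokesRegularity.Theorems.blowup_clay_uniqueness
      ν hν (v 0) hdec u' v p' q T hT hu' hp' hns hbe hcl hLH rfl
  have hcl' : Literature.Analysis.FluidPDE.IsClassicalNSSolutionOn (Set.Ici 0) ν 0 u' p' :=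
    ⟨hu', hp', fun t ht x => hns.momentum t ht x, fun t ht => hns.divFree t ht⟩
  refine hmax ⟨T + 1, by linarith, u', p', ?_, heq⟩
  exact hcl'.mono (fun t ht => ht.1) (uniqueDiffOn_Ico 0 (T + 1))




/-! ## A1L versions of the SPLIT CHILDREN of 27849 (28295 / 28296 / 28297) and of the glue 28298 — port of the landed
`Theorems/FilamentSkeletonRssSkeletonJ1GSplit.lean` (tenure g16 resync) with the SAME one-conjunct swap; the unchanged piece predicates
(`Clause12J1G`, `Clause13J1G`, `NearStraightJ1G`, `StraightDatum`) and the landed general-position datum `straightDatumGP_exists` are IMPORTED, not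
copied.  The inlined binder texts of `skeletonJ1L_of_subs` are the children texts the tenure would file under A1L. -/
section SplitA1L
open Summit.NavierStokesRegularity.NavierStokesRegularity.Theorems.SelectionBoxRJRung
open Summit.NavierStokesRegularity.NavierStokesRegularity.Theorems.FilamentSkeletonRssSkeletonJ1GStubStraightDatum
open Summit.NavierStokesRegularity.NavierStokesRegularity.Theorems.FilamentSkeletonRssSkeletonJ1GSplit
  (Clause12J1G Clause13J1G NearStraightJ1G StraightDatum straightDatumGP_exists)

/-- The matrix of `SkeletonJ1L` — everything after `∀ Γ ≥ Γ₂, ∃ data` — VERBATIM. [folklore] -/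
def J1LMatrix (N : ℕ) (δ ρ K Λ a b cnd Rw Rb cg θ₀ KA Γ : ℝ) (γ : Fin N → ℝ) (α : ℝ) (X : Fin N → ℝ → EuclideanSpace ℝ (Fin 3))
    (w : Fin N → ℝ → ℝ) (c : Fin N → ℝ) (m n : Fin N → EuclideanSpace ℝ (Fin 3)) (Aa : Fin N → ℝ → ℝ) : Prop :=
  ∀ (u:(Fin N → ℝ → EuclideanSpace ℝ (Fin 3)) → EuclideanSpace ℝ (Fin 3) → EuclideanSpace ℝ (Fin 3)) (v:EuclideanSpace ℝ (Fin 3) → EuclideanSpace ℝ (Fin 3)) (A:Fin N → (EuclideanSpace ℝ (Fin 3) →L[ℝ] EuclideanSpace ℝ (Fin 3))) (T:(Fin N → ℝ → EuclideanSpace ℝ (Fin 3)) → Fin N → ℝ → EuclideanSpace ℝ (Fin 3)), (∀ Z y, u Z y = ∑ k, (Γ*γ k/(4*Real.pi))•∫ σ:ℝ, ((‖y-Z k σ‖^2+Real.exp (-(1+Real.eulerMascheroniConstant-Real.log 2))*Aa k σ)^(3/2:ℝ))⁻¹•cross (deriv (Z k) σ) (y-Z k σ))→(∀ y, v y = u X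 y+(1/2:ℝ)•y-α•cross (EuclideanSpace.single 2 1) y)→(∀ j, A j = fderiv ℝ v (X j (c j)))→(∀ Z j τ, T Z j τ = (u Z (Z j τ)+(1/2:ℝ)•Z j τ-α•cross (EuclideanSpace.single 2 1) (Z j τ))-(⟪u Z (Z j τ)+(1/2:ℝ)•Z j τ-α•cross (EuclideanSpace.single 2 1) (Z j τ), deriv (Z j) τ⟫_ℝ/‖deriv (Z j) τ‖^2)•deriv (Z j) τ)→(α ≠ 0 ∧ (∀ j, γ j ≠ 0) ∧ (∀ j, ContDiff ℝ 2 (X j) ∧ Differentiable ℝ (w j)∧(∀ τ, ‖deriv (X j) τ‖ = 1)∧(∀ τ, ‖iteratedDeriv 2 (X j) τ‖*√Γ≤K) ∧ Tendsto (fun τ => ‖X j τ‖) (cocompact ℝ) atTop) ∧ (∀ j k, j ≠ k → ∀ τ σ, ρ*√Γ≤‖X j τ-X k σ‖) ∧ (∀ j τ σ, ρ*√Γ≤|τ-σ| → cg*ρ*√Γ≤‖X j τ-X j σ‖) ∧ (∀ j τ, cg*|τ-c j|≤Rw*√Γ+‖X j τ‖) ∧ (∀ j τ, w j τ = ⟪v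 (X j τ), deriv (X j) τ⟫_ℝ) ∧ (∀ j τ, ‖X j τ‖≤Rb*√(Γ*Real.log Γ) → v (X j τ) = w j τ•deriv (X j) τ) ∧ (∀ j, ‖X j (c j)‖≤Rw*√Γ) ∧ (∀ j, |⟪deriv (X j) (c j), EuclideanSpace.single 2 1⟫_ℝ|≤1-θ₀) ∧ (θ₀≤|α| ∧ |α|≤θ₀⁻¹ ∧ ∀ j, θ₀≤|γ j| ∧ |γ j|≤θ₀⁻¹) ∧ (∀ j, w j (c j) = 0 ∧ (∀ τ, w j τ = 0 → τ = c j) ∧ 3/2+δ≤deriv (w j) (c j) ∧ deriv (w j) (c j)≤Λ) ∧ (∀ j, Differentiable ℝ (Aa j) ∧ (∀ τ, 0 < Aa j τ) ∧ 1≤KA*Aa j (c j) ∧ ∀ τ, ‖X j τ‖≤2*Rb*√(Γ*Real.log Γ) → Aa j τ = Aa j (c j)) ∧ (∀ j τ, Rw^2*Γ*Aa j τ≤KA*(Rw^2*Γ+‖X j τ‖^2)) ∧ (∀ j, Orthonormal ℝ ![deriv (X j) (c j), m j, n j] ∧ ⟪A j (m j), m j⟫_ℝ+⟪A j (n j), n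 j⟫_ℝ < 0 ∧ ⟪A j (n j), m j⟫_ℝ * ⟪A j (m j), n j⟫_ℝ < ⟪A j (m j), m j⟫_ℝ * ⟪A j (n j), n j⟫_ℝ) ∧ (∀ Y:Fin N → ℝ → EuclideanSpace ℝ (Fin 3), (∀ j, ContDiff ℝ 2 (Y j))→(∀ j τ, ⟪Y j τ, deriv (X j) τ⟫_ℝ = 0) → (∀ j τ, Rb*√(Γ*Real.log Γ) < ‖X j τ‖ → Y j τ = 0) → ∑ j, ⟪Y j (c j), cross (EuclideanSpace.single 2 1) (X j (c j))⟫_ℝ = 0 → (∀ j τ, ‖Y j τ‖+‖deriv (Y j) τ‖+‖iteratedDeriv 2 (Y j) τ‖≤(1+|τ-c j|)^b) → ∀ L:ℝ, (∀ j τ, ‖deriv (fun s:ℝ => T (fun k σ => X k σ+s•Y k σ) j τ) 0‖≤L*(1+|τ-c j|)^a) → ∀ j τ, ‖Y j τ‖≤cnd*L*(1+|τ-c j|)^b))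

/-- FLAT PART of the matrix: clauses 0–11, the area law and the Γ-flat cone bound, verbatim. [folklore] -/
def FlatJ1L (N : ℕ) (δ ρ K Λ Rw Rb cg θ₀ KA Γ : ℝ) (γ : Fin N → ℝ) (α : ℝ) (X : Fin N → ℝ → EuclideanSpace ℝ (Fin 3))
    (w : Fin N → ℝ → ℝ) (c : Fin N → ℝ) (Aa : Fin N → ℝ → ℝ) : Prop :=
  ∀ (u:(Fin N → ℝ → EuclideanSpace ℝ (Fin 3)) → EuclideanSpace ℝ (Fin 3) → EuclideanSpace ℝ (Fin 3)) (v:EuclideanSpace ℝ (Fin 3) → EuclideanSpace ℝ (Fin 3)) (A:Fin N → (EuclideanSpace ℝ (Fin 3) →L[ℝ] EuclideanSpace ℝ (Fin 3))) (T:(Fin N → ℝ → EuclideanSpace ℝ (Fin 3)) → Fin N → ℝ → EuclideanSpace ℝ (Fin 3)), (∀ Z y, u Z y = ∑ k, (Γ*γ k/(4*Real.pi))•∫ σ:ℝ, ((‖y-Z k σ‖^2+Real.exp (-(1+Real.eulerMascheroniConstant-Real.log 2))*Aa k σ)^(3/2:ℝ))⁻¹•cross (deriv (Z k) σ) (y-Z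 k σ))→(∀ y, v y = u X y+(1/2:ℝ)•y-α•cross (EuclideanSpace.single 2 1) y)→(∀ j, A j = fderiv ℝ v (X j (c j)))→(∀ Z j τ, T Z j τ = (u Z (Z j τ)+(1/2:ℝ)•Z j τ-α•cross (EuclideanSpace.single 2 1) (Z j τ))-(⟪u Z (Z j τ)+(1/2:ℝ)•Z j τ-α•cross (EuclideanSpace.single 2 1) (Z j τ), deriv (Z j) τ⟫_ℝ/‖deriv (Z j) τ‖^2)•deriv (Z j) τ)→(α ≠ 0 ∧ (∀ j, γ j ≠ 0) ∧ (∀ j, ContDiff ℝ 2 (X j) ∧ Differentiable ℝ (w j)∧(∀ τ, ‖deriv (X j) τ‖ = 1)∧(∀ τ, ‖iteratedDeriv 2 (X j) τ‖*√Γ≤K) ∧ Tendsto (fun τ => ‖X j τ‖) (cocompact ℝ) atTop) ∧ (∀ j k, j ≠ k → ∀ τ σ, ρ*√Γ≤‖X j τ-X k σ‖) ∧ (∀ j τ σ, ρ*√Γ≤|τ-σ| → cg*ρ*√Γ≤‖X j τ-X j σ‖) ∧ (∀ j τ, cg*|τ-c j|≤Rw*√Γ+‖X j τ‖) ∧ (∀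 j τ, w j τ = ⟪v (X j τ), deriv (X j) τ⟫_ℝ) ∧ (∀ j τ, ‖X j τ‖≤Rb*√(Γ*Real.log Γ) → v (X j τ) = w j τ•deriv (X j) τ) ∧ (∀ j, ‖X j (c j)‖≤Rw*√Γ) ∧ (∀ j, |⟪deriv (X j) (c j), EuclideanSpace.single 2 1⟫_ℝ|≤1-θ₀) ∧ (θ₀≤|α| ∧ |α|≤θ₀⁻¹ ∧ ∀ j, θ₀≤|γ j| ∧ |γ j|≤θ₀⁻¹) ∧ (∀ j, w j (c j) = 0 ∧ (∀ τ, w j τ = 0 → τ = c j) ∧ 3/2+δ≤deriv (w j) (c j) ∧ deriv (w j) (c j)≤Λ) ∧ (∀ j, Differentiable ℝ (Aa j) ∧ (∀ τ, 0 < Aa j τ) ∧ 1≤KA*Aa j (c j) ∧ ∀ τ, ‖X j τ‖≤2*Rb*√(Γ*Real.log Γ) → Aa j τ = Aa j (c j)) ∧ (∀ j τ, Rw^2*Γ*Aa j τ≤KA*(Rw^2*Γ+‖X j τ‖^2)))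

/-- SUB-CRUX 1 (XL): exactly tangent near-straight core-matched skeletons shadow every GENERAL-POSITION straight skew
datum, for every small tolerance `Rb` and all large `Γ`. (route-posited stub statement; not a Literature fact) -/
def TangentSkeletonNearStraightL : Prop :=
  ∀ (N : ℕ) (δd ρd Λd Rwd θd mw : ℝ) (p t : Fin N → EuclideanSpace ℝ (Fin 3)) (γ : Fin N → ℝ) (α : ℝ) (s₀ : Fin N → ℝ),
    0 < N → 0 < δd → 0 < ρd → 0 < Rwd → 0 < θd → 0 < mw → StraightDatum N δd ρd Λd Rwd θd mw p t γ α s₀ →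
    (∀ j k, j ≠ k → |⟪t j, t k⟫_ℝ| ≤ 1 - θd) →
    ∃ (δ ρ K Λ Rw cg θ₀ KA Rb₁ : ℝ), 0 < δ ∧ 0 < ρ ∧ 0 < Rw ∧ 0 < cg ∧ 0 < θ₀ ∧ 0 < Rb₁ ∧
      2 * K * ρ ≤ 1 ∧ ∀ Rb : ℝ, 0 < Rb → Rb ≤ Rb₁ → ∃ Γ₂ : ℝ, ∀ Γ : ℝ, Γ₂ ≤ Γ →
        ∃ (X : Fin N → ℝ → EuclideanSpace ℝ (Fin 3)) (w : Fin N → ℝ → ℝ) (c : Fin N → ℝ) (Aa : Fin N → ℝ → ℝ),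
          FlatJ1L N δ ρ K Λ Rw Rb cg θ₀ KA Γ γ α X w c Aa ∧ NearStraightJ1G N Λ Rb X w Aa

/-- SUB-CRUX 2 (M–L): clause 13-J for near-straight exactly tangent skeletons, `Rb ≤ Rb₀(consts)`, `Γ ≥ Γ₀(consts, Rb)`
(registered S3 verbatim). (route-posited stub statement; not a Literature fact) -/
def Clause13NearStraightL : Prop :=
  ∀ (N : ℕ) (δ ρ K Λ Rw cg θ₀ KA : ℝ), 0 < N → 0 < δ → 0 < ρ → 0 < Rw → 0 < cg → 0 < θ₀ →
    ∃ Rb₀ : ℝ, 0 < Rb₀ ∧ ∀ Rb : ℝ, 0 < Rb → Rb ≤ Rb₀ → ∃ (a b cnd Γ₀ : ℝ), 0 ≤ a ∧ 0 < cnd ∧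
      ∀ Γ : ℝ, Γ₀ ≤ Γ → ∀ (γ : Fin N → ℝ) (α : ℝ) (X : Fin N → ℝ → EuclideanSpace ℝ (Fin 3)) (w : Fin N → ℝ → ℝ)
        (c : Fin N → ℝ) (Aa : Fin N → ℝ → ℝ),
        FlatJ1L N δ ρ K Λ Rw Rb cg θ₀ KA Γ γ α X w c Aa → NearStraightJ1G N Λ Rb X w Aa →
          Clause13J1G N a b cnd Rb Γ γ α X w c Aa

/-- SUB-CRUX 3 (M): the normal block (clause 12) from the flat clauses IN THE NEAR-STRAIGHT REGIME (hypothesis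
`NearStraightJ1G`: tangent oscillation `≤ Rb`, `|w′| ≤ Λ`, core-area floor `Λ⁻¹ ≤ Aa`), matched kernel, `2Kρ ≤ 1`,
`Γ ≥ Γ₀(consts)` — the RESHAPED registered S4 (skeleton of record 888398bc7a8b5bf0, lane 19175-p1 g11 reshape adopted by
tenure g16 at 2026-08-28T15:05:01Z; the area floor is what the matched-kernel port of `clause12_of_skeleton` needs). (route-posited stub statement; not a Literature fact) -/
def NormalBlockMatchedL : Prop :=
  ∀ (N : ℕ) (δ ρ K Λ Rw Rb cg θ₀ KA : ℝ), 0 < N → 0 < δ → 0 < ρ → 0 < Rw → 0 < Rb → 0 < cg → 0 < θ₀ →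
    2 * K * ρ ≤ 1 → ∃ Γ₀ : ℝ, ∀ Γ : ℝ, Γ₀ ≤ Γ → ∀ (γ : Fin N → ℝ) (α : ℝ) (X : Fin N → ℝ → EuclideanSpace ℝ (Fin 3))
      (w : Fin N → ℝ → ℝ) (c : Fin N → ℝ) (Aa : Fin N → ℝ → ℝ),
      FlatJ1L N δ ρ K Λ Rw Rb cg θ₀ KA Γ γ α X w c Aa → NearStraightJ1G N Λ Rb X w Aa → Clause12J1G N Γ γ α X w c Aa

/-- `J1LMatrix` is the matrix of the route decl `SkeletonJ1L` verbatim (definitional `Iff.rfl`). [folklore] -/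
theorem skeletonJ1L_iff_matrix :
    SkeletonJ1L ↔ ∃ (N : ℕ) (δ ρ K Λ a b cnd η Rw Rb cg θ₀ KA Γ₂ : ℝ), 0 < N ∧ 0 < δ ∧ 0 < ρ ∧ 0 ≤ a ∧ 0 < cnd ∧
      0 < η ∧ 0 < Rw ∧ 0 < Rb ∧ 0 < cg ∧ 0 < θ₀ ∧ ∀ Γ : ℝ, Γ₂ ≤ Γ →
        ∃ (γ : Fin N → ℝ) (α : ℝ) (X : Fin N → ℝ → EuclideanSpace ℝ (Fin 3)) (w : Fin N → ℝ → ℝ) (c : Fin N → ℝ)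
          (m n : Fin N → EuclideanSpace ℝ (Fin 3)) (Aa : Fin N → ℝ → ℝ), J1LMatrix N δ ρ K Λ a b cnd Rw Rb cg θ₀ KA Γ γ α X w c m n Aa :=
  Iff.rfl

/-- COMPOSITION through the matrix: the three sub-cruxes imply the matrix form of `SkeletonJ1L`; the datum is the landed
general-position witness (§3).  Constants threaded `Rb := min Rb₀ Rb₁`, `η := 1`, `Γ₂ := max Γ₂ (max Γ₀ Γ₁)`; then the
flat clauses, clause 12 and clause 13-J are re-assembled in the crux's order. [folklore] -/
theorem skeletonJ1L_matrix_of_pieces (h2 : TangentSkeletonNearStraightL) (h3 : Clause13NearStraightL)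
    (h4 : NormalBlockMatchedL) :
    ∃ (N : ℕ) (δ ρ K Λ a b cnd η Rw Rb cg θ₀ KA Γ₂ : ℝ), 0 < N ∧ 0 < δ ∧ 0 < ρ ∧ 0 ≤ a ∧ 0 < cnd ∧
      0 < η ∧ 0 < Rw ∧ 0 < Rb ∧ 0 < cg ∧ 0 < θ₀ ∧ ∀ Γ : ℝ, Γ₂ ≤ Γ →
        ∃ (γ : Fin N → ℝ) (α : ℝ) (X : Fin N → ℝ → EuclideanSpace ℝ (Fin 3)) (w : Fin N → ℝ → ℝ) (c : Fin N → ℝ)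
          (m n : Fin N → EuclideanSpace ℝ (Fin 3)) (Aa : Fin N → ℝ → ℝ), J1LMatrix N δ ρ K Λ a b cnd Rw Rb cg θ₀ KA Γ γ α X w c m n Aa := by
  obtain ⟨N, δd, ρd, Λd, Rwd, θd, mw, p, t, γ, α, s₀, hN, hδ, hρ, hRw, hθ, hmw, hSD, hGP⟩ := straightDatumGP_exists
  obtain ⟨δ', ρ', K, Λ', Rw', cg, θ₀', KA, Rb₁, hδ', hρ', hRw', hcg, hθ₀', hRb₁, hKρ, hfam⟩ :=
    h2 N δd ρd Λd Rwd θd mw p t γ α s₀ hN hδ hρ hRw hθ hmw hSD hGP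
  obtain ⟨Rb₀, hRb₀, h13⟩ := h3 N δ' ρ' K Λ' Rw' cg θ₀' KA hN hδ' hρ' hRw' hcg hθ₀'
  have hRb : 0 < min Rb₀ Rb₁ := lt_min hRb₀ hRb₁
  obtain ⟨a, b, cnd, Γ₀, ha, hcnd, h13'⟩ := h13 (min Rb₀ Rb₁) hRb (min_le_left _ _)
  obtain ⟨Γ₂, hfam'⟩ := hfam (min Rb₀ Rb₁) hRb (min_le_right _ _)
  obtain ⟨Γ₁, h12⟩ := h4 N δ' ρ' K Λ' Rw' (min Rb₀ Rb₁) cg θ₀' KA hN hδ' hρ' hRw' hRb hcg hθ₀' hKρ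
  refine ⟨N, δ', ρ', K, Λ', a, b, cnd, 1, Rw', min Rb₀ Rb₁, cg, θ₀', KA, max Γ₂ (max Γ₀ Γ₁), hN, hδ', hρ', ha, hcnd,
    one_pos, hRw', hRb, hcg, hθ₀', ?_⟩
  intro Γ hΓ
  have hΓ₂ : Γ₂ ≤ Γ := le_trans (le_max_left _ _) hΓ
  have hΓ₀ : Γ₀ ≤ Γ := le_trans (le_trans (le_max_left _ _) (le_max_right _ _)) hΓ
  have hΓ₁ : Γ₁ ≤ Γ := le_trans (le_trans (le_max_right _ _) (le_max_right _ _)) hΓ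
  obtain ⟨X, w, c, Aa, hflat, hns⟩ := hfam' Γ hΓ₂
  have hc13 := h13' Γ hΓ₀ γ α X w c Aa hflat hns
  obtain ⟨m, n, hc12⟩ := h12 Γ hΓ₁ γ α X w c Aa hflat hns
  refine ⟨γ, α, X, w, c, m, n, Aa, ?_⟩
  intro u v A T hu hv hA hT
  obtain ⟨k0, k1, k2, k3, k4, k5, k6, k7, k8, k9, k10, k11, k12, k13⟩ := hflat u v A T hu hv hA hT
  exact ⟨k0, k1, k2, k3, k4, k5, k6, k7, k8, k9, k10, k11, k12, k13, hc12 u v A T hu hv hA hT, hc13 u v A T hu hv hA hT⟩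

/-- **THE SPLIT IMPLICATION (structured form)**: `TangentSkeletonNearStraightL → Clause13NearStraightL → NormalBlockMatchedL →
SkeletonJ1L`, the crux BY NAME. [folklore] -/
theorem skeletonJ1L_of_pieces (h2 : TangentSkeletonNearStraightL) (h3 : Clause13NearStraightL) (h4 : NormalBlockMatchedL) :
    SkeletonJ1L :=
  skeletonJ1L_iff_matrix.mpr (skeletonJ1L_matrix_of_pieces h2 h3 h4)

/-- Child 1 as filed on the route (fully inlined) is `TangentSkeletonNearStraightL` (definitional). [folklore] -/
theorem tangentSkeletonNearStraightL_iff :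
    (open Literature.Analysis.FluidPDE in ∀ (N : ℕ) (δd ρd Λd Rwd θd mw : ℝ) (p t : Fin N → EuclideanSpace ℝ (Fin 3)) (γ : Fin N → ℝ) (α : ℝ) (s₀ : Fin N → ℝ), 0 < N → 0 < δd → 0 < ρd → 0 < Rwd → 0 < θd → 0 < mw → ((∀ j, ‖t j‖ = 1) ∧ (∀ j k, j ≠ k → ∀ τ σ : ℝ, ρd ≤ ‖(p j + τ • t j) - (p k + σ • t k)‖) ∧ (∀ j, |⟪t j, EuclideanSpace.single 2 1⟫_ℝ| ≤ 1 - θd) ∧ (θd ≤ |α| ∧ |α| ≤ θd⁻¹ ∧ ∀ j, θd ≤ |γ j| ∧ |γ j| ≤ θd⁻¹) ∧ (∀ j, ‖p j + s₀ j • t j‖ ≤ Rwd) ∧ (∀ W : Fin N → ℝ → ℝ, (∀ j s, W j s = ⟪(∑ k ∈ Finset.univ.erase j, (γ k / (2 * Real.pi)) • ((‖(p j + s • t j - p k) - ⟪p j + s • t j - p k, t k⟫_ℝ • t k‖ ^ 2)⁻¹ • cross (t k) ((p j + s • t j - p k) - ⟪p j + s • t j - p k, t k⟫_ℝ • t k)))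 + (1 / 2 : ℝ) • (p j + s • t j) - α • cross (EuclideanSpace.single 2 1) (p j + s • t j), t j⟫_ℝ) → ∀ j, W j (s₀ j) = 0 ∧ (∀ s, mw * |s - s₀ j| ≤ |W j s|) ∧ 3 / 2 + δd ≤ deriv (W j) (s₀ j) ∧ (∀ s, |deriv (W j) s| ≤ Λd))) → (∀ j k, j ≠ k → |⟪t j, t k⟫_ℝ| ≤ 1 - θd) → ∃ (δ ρ K Λ Rw cg θ₀ KA Rb₁ : ℝ), 0 < δ ∧ 0 < ρ ∧ 0 < Rw ∧ 0 < cg ∧ 0 < θ₀ ∧ 0 < Rb₁ ∧ 2 * K * ρ ≤ 1 ∧ ∀ Rb : ℝ, 0 < Rb → Rb ≤ Rb₁ → ∃ Γ₂ : ℝ, ∀ Γ : ℝ, Γ₂ ≤ Γ → ∃ (X : Fin N → ℝ → EuclideanSpace ℝ (Fin 3)) (w : Fin N → ℝ → ℝ) (c : Fin N → ℝ) (Aa : Fin N → ℝ → ℝ), (∀ (u:(Fin N → ℝ → EuclideanSpace ℝ (Fin 3)) → EuclideanSpace ℝ (Fin 3) → EuclideanSpace ℝ (Fin 3)) (v:EuclideanSpace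 ℝ (Fin 3) → EuclideanSpace ℝ (Fin 3)) (A:Fin N → (EuclideanSpace ℝ (Fin 3) →L[ℝ] EuclideanSpace ℝ (Fin 3))) (T:(Fin N → ℝ → EuclideanSpace ℝ (Fin 3)) → Fin N → ℝ → EuclideanSpace ℝ (Fin 3)), (∀ Z y, u Z y = ∑ k, (Γ*γ k/(4*Real.pi))•∫ σ:ℝ, ((‖y-Z k σ‖^2+Real.exp (-(1+Real.eulerMascheroniConstant-Real.log 2))*Aa k σ)^(3/2:ℝ))⁻¹•cross (deriv (Z k) σ) (y-Z k σ))→(∀ y, v y = u X y+(1/2:ℝ)•y-α•cross (EuclideanSpace.single 2 1) y)→(∀ j, A j = fderiv ℝ v (X j (c j)))→(∀ Z j τ, T Z j τ = (u Z (Z j τ)+(1/2:ℝ)•Z j τ-α•cross (EuclideanSpace.single 2 1) (Z j τ))-(⟪u Z (Z j τ)+(1/2:ℝ)•Z j τ-α•cross (EuclideanSpace.single 2 1) (Z j τ), deriv (Z j) τ⟫_ℝ/‖deriv (Z j) τ‖^2)•deriv (Z j) τ)→(α ≠ 0 ∧ (∀ j, γ j ≠ 0) ∧ (∀ j, ContDiff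 ℝ 2 (X j) ∧ Differentiable ℝ (w j)∧(∀ τ, ‖deriv (X j) τ‖ = 1)∧(∀ τ, ‖iteratedDeriv 2 (X j) τ‖*√Γ≤K) ∧ Tendsto (fun τ => ‖X j τ‖) (cocompact ℝ) atTop) ∧ (∀ j k, j ≠ k → ∀ τ σ, ρ*√Γ≤‖X j τ-X k σ‖) ∧ (∀ j τ σ, ρ*√Γ≤|τ-σ| → cg*ρ*√Γ≤‖X j τ-X j σ‖) ∧ (∀ j τ, cg*|τ-c j|≤Rw*√Γ+‖X j τ‖) ∧ (∀ j τ, w j τ = ⟪v (X j τ), deriv (X j) τ⟫_ℝ) ∧ (∀ j τ, ‖X j τ‖≤Rb*√(Γ*Real.log Γ) → v (X j τ) = w j τ•deriv (X j) τ) ∧ (∀ j, ‖X j (c j)‖≤Rw*√Γ) ∧ (∀ j, |⟪deriv (X j) (c j), EuclideanSpace.single 2 1⟫_ℝ|≤1-θ₀) ∧ (θ₀≤|α| ∧ |α|≤θ₀⁻¹ ∧ ∀ j, θ₀≤|γ j| ∧ |γ j|≤θ₀⁻¹) ∧ (∀ j, w j (c j) = 0 ∧ (∀ τ, w j τ = 0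 → τ = c j) ∧ 3/2+δ≤deriv (w j) (c j) ∧ deriv (w j) (c j)≤Λ) ∧ (∀ j, Differentiable ℝ (Aa j) ∧ (∀ τ, 0 < Aa j τ) ∧ 1≤KA*Aa j (c j) ∧ ∀ τ, ‖X j τ‖≤2*Rb*√(Γ*Real.log Γ) → Aa j τ = Aa j (c j)) ∧ (∀ j τ, Rw^2*Γ*Aa j τ≤KA*(Rw^2*Γ+‖X j τ‖^2)))) ∧ ((∀ j τ σ, ‖deriv (X j) τ - deriv (X j) σ‖ ≤ Rb) ∧ (∀ j τ, |deriv (w j) τ| ≤ Λ) ∧ (∀ j τ, Λ⁻¹ ≤ Aa j τ))) ↔ TangentSkeletonNearStraightL :=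
  Iff.rfl

/-- Child 2 as filed on the route (fully inlined) is `Clause13NearStraightL` (definitional). [folklore] -/
theorem clause13NearStraightL_iff :
    (open Literature.Analysis.FluidPDE in ∀ (N : ℕ) (δ ρ K Λ Rw cg θ₀ KA : ℝ), 0 < N → 0 < δ → 0 < ρ → 0 < Rw → 0 < cg → 0 < θ₀ → ∃ Rb₀ : ℝ, 0 < Rb₀ ∧ ∀ Rb : ℝ, 0 < Rb → Rb ≤ Rb₀ → ∃ (a b cnd Γ₀ : ℝ), 0 ≤ a ∧ 0 < cnd ∧ ∀ Γ : ℝ, Γ₀ ≤ Γ → ∀ (γ : Fin N → ℝ) (α : ℝ) (X : Fin N → ℝ → EuclideanSpace ℝ (Fin 3)) (w : Fin N → ℝ → ℝ) (c : Fin N → ℝ) (Aa : Fin N → ℝ → ℝ), (∀ (u:(Fin N → ℝ → EuclideanSpace ℝ (Fin 3)) → EuclideanSpace ℝ (Fin 3) → EuclideanSpace ℝ (Fin 3)) (v:EuclideanSpace ℝ (Fin 3) → EuclideanSpace ℝ (Fin 3)) (A:Fin N → (EuclideanSpace ℝ (Fin 3) →L[ℝ] EuclideanSpace ℝ (Fin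 3))) (T:(Fin N → ℝ → EuclideanSpace ℝ (Fin 3)) → Fin N → ℝ → EuclideanSpace ℝ (Fin 3)), (∀ Z y, u Z y = ∑ k, (Γ*γ k/(4*Real.pi))•∫ σ:ℝ, ((‖y-Z k σ‖^2+Real.exp (-(1+Real.eulerMascheroniConstant-Real.log 2))*Aa k σ)^(3/2:ℝ))⁻¹•cross (deriv (Z k) σ) (y-Z k σ))→(∀ y, v y = u X y+(1/2:ℝ)•y-α•cross (EuclideanSpace.single 2 1) y)→(∀ j, A j = fderiv ℝ v (X j (c j)))→(∀ Z j τ, T Z j τ = (u Z (Z j τ)+(1/2:ℝ)•Z j τ-α•cross (EuclideanSpace.single 2 1) (Z j τ))-(⟪u Z (Z j τ)+(1/2:ℝ)•Z j τ-α•cross (EuclideanSpace.single 2 1) (Z j τ), deriv (Z j) τ⟫_ℝ/‖deriv (Z j) τ‖^2)•deriv (Z j) τ)→(α ≠ 0 ∧ (∀ j, γ j ≠ 0) ∧ (∀ j, ContDiff ℝ 2 (X j) ∧ Differentiable ℝ (w j)∧(∀ τ, ‖deriv (X j) τ‖ = 1)∧(∀ τ, ‖iteratedDeriv 2 (X j)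 τ‖*√Γ≤K) ∧ Tendsto (fun τ => ‖X j τ‖) (cocompact ℝ) atTop) ∧ (∀ j k, j ≠ k → ∀ τ σ, ρ*√Γ≤‖X j τ-X k σ‖) ∧ (∀ j τ σ, ρ*√Γ≤|τ-σ| → cg*ρ*√Γ≤‖X j τ-X j σ‖) ∧ (∀ j τ, cg*|τ-c j|≤Rw*√Γ+‖X j τ‖) ∧ (∀ j τ, w j τ = ⟪v (X j τ), deriv (X j) τ⟫_ℝ) ∧ (∀ j τ, ‖X j τ‖≤Rb*√(Γ*Real.log Γ) → v (X j τ) = w j τ•deriv (X j) τ) ∧ (∀ j, ‖X j (c j)‖≤Rw*√Γ) ∧ (∀ j, |⟪deriv (X j) (c j), EuclideanSpace.single 2 1⟫_ℝ|≤1-θ₀) ∧ (θ₀≤|α| ∧ |α|≤θ₀⁻¹ ∧ ∀ j, θ₀≤|γ j| ∧ |γ j|≤θ₀⁻¹) ∧ (∀ j, w j (c j) = 0 ∧ (∀ τ, w j τ = 0 → τ = c j) ∧ 3/2+δ≤deriv (w j) (c j) ∧ deriv (w j) (c j)≤Λ) ∧ (∀ j, Differentiable ℝ (Aa j) ∧ (∀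 τ, 0 < Aa j τ) ∧ 1≤KA*Aa j (c j) ∧ ∀ τ, ‖X j τ‖≤2*Rb*√(Γ*Real.log Γ) → Aa j τ = Aa j (c j)) ∧ (∀ j τ, Rw^2*Γ*Aa j τ≤KA*(Rw^2*Γ+‖X j τ‖^2)))) → ((∀ j τ σ, ‖deriv (X j) τ - deriv (X j) σ‖ ≤ Rb) ∧ (∀ j τ, |deriv (w j) τ| ≤ Λ) ∧ (∀ j τ, Λ⁻¹ ≤ Aa j τ)) → (∀ (u:(Fin N → ℝ → EuclideanSpace ℝ (Fin 3)) → EuclideanSpace ℝ (Fin 3) → EuclideanSpace ℝ (Fin 3)) (v:EuclideanSpace ℝ (Fin 3) → EuclideanSpace ℝ (Fin 3)) (A:Fin N → (EuclideanSpace ℝ (Fin 3) →L[ℝ] EuclideanSpace ℝ (Fin 3))) (T:(Fin N → ℝ → EuclideanSpace ℝ (Fin 3)) → Fin N → ℝ → EuclideanSpace ℝ (Fin 3)), (∀ Z y, u Z y = ∑ k, (Γ*γ k/(4*Real.pi))•∫ σ:ℝ, ((‖y-Z k σ‖^2+Real.exp (-(1+Real.eulerMascheroniConstant-Real.log 2))*Aa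 k σ)^(3/2:ℝ))⁻¹•cross (deriv (Z k) σ) (y-Z k σ))→(∀ y, v y = u X y+(1/2:ℝ)•y-α•cross (EuclideanSpace.single 2 1) y)→(∀ j, A j = fderiv ℝ v (X j (c j)))→(∀ Z j τ, T Z j τ = (u Z (Z j τ)+(1/2:ℝ)•Z j τ-α•cross (EuclideanSpace.single 2 1) (Z j τ))-(⟪u Z (Z j τ)+(1/2:ℝ)•Z j τ-α•cross (EuclideanSpace.single 2 1) (Z j τ), deriv (Z j) τ⟫_ℝ/‖deriv (Z j) τ‖^2)•deriv (Z j) τ)→(∀ Y:Fin N → ℝ → EuclideanSpace ℝ (Fin 3), (∀ j, ContDiff ℝ 2 (Y j))→(∀ j τ, ⟪Y j τ, deriv (X j) τ⟫_ℝ = 0) → (∀ j τ, Rb*√(Γ*Real.log Γ) < ‖X j τ‖ → Y j τ = 0) → ∑ j, ⟪Y j (c j), cross (EuclideanSpace.single 2 1) (X j (c j))⟫_ℝ = 0 → (∀ j τ, ‖Y j τ‖+‖deriv (Y j) τ‖+‖iteratedDeriv 2 (Y j) τ‖≤(1+|τ-c j|)^b) → ∀ L:ℝ, (∀ j τ, ‖deriv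 (fun s:ℝ => T (fun k σ => X k σ+s•Y k σ) j τ) 0‖≤L*(1+|τ-c j|)^a) → ∀ j τ, ‖Y j τ‖≤cnd*L*(1+|τ-c j|)^b))) ↔ Clause13NearStraightL :=
  Iff.rfl

/-- Child 3 as filed on the route (fully inlined) is `NormalBlockMatchedL` (definitional). [folklore] -/
theorem normalBlockMatchedL_iff :
    (open Literature.Analysis.FluidPDE in ∀ (N : ℕ) (δ ρ K Λ Rw Rb cg θ₀ KA : ℝ), 0 < N → 0 < δ → 0 < ρ → 0 < Rw → 0 < Rb → 0 < cg → 0 < θ₀ → 2 * K * ρ ≤ 1 → ∃ Γ₀ : ℝ, ∀ Γ : ℝ, Γ₀ ≤ Γ → ∀ (γ : Fin N → ℝ) (α : ℝ) (X : Fin N → ℝ → EuclideanSpace ℝ (Fin 3)) (w : Fin N → ℝ → ℝ) (c : Fin N → ℝ) (Aa : Fin N → ℝ → ℝ), (∀ (u:(Fin N → ℝ → EuclideanSpace ℝ (Fin 3)) → EuclideanSpace ℝ (Fin 3) → EuclideanSpace ℝ (Fin 3)) (v:EuclideanSpace ℝ (Fin 3) → EuclideanSpace ℝ (Fin 3)) (A:Fin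 N → (EuclideanSpace ℝ (Fin 3) →L[ℝ] EuclideanSpace ℝ (Fin 3))) (T:(Fin N → ℝ → EuclideanSpace ℝ (Fin 3)) → Fin N → ℝ → EuclideanSpace ℝ (Fin 3)), (∀ Z y, u Z y = ∑ k, (Γ*γ k/(4*Real.pi))•∫ σ:ℝ, ((‖y-Z k σ‖^2+Real.exp (-(1+Real.eulerMascheroniConstant-Real.log 2))*Aa k σ)^(3/2:ℝ))⁻¹•cross (deriv (Z k) σ) (y-Z k σ))→(∀ y, v y = u X y+(1/2:ℝ)•y-α•cross (EuclideanSpace.single 2 1) y)→(∀ j, A j = fderiv ℝ v (X j (c j)))→(∀ Z j τ, T Z j τ = (u Z (Z j τ)+(1/2:ℝ)•Z j τ-α•cross (EuclideanSpace.single 2 1) (Z j τ))-(⟪u Z (Z j τ)+(1/2:ℝ)•Z j τ-α•cross (EuclideanSpace.single 2 1) (Z j τ), deriv (Z j) τ⟫_ℝ/‖deriv (Z j) τ‖^2)•deriv (Z j) τ)→(α ≠ 0 ∧ (∀ j, γ j ≠ 0) ∧ (∀ j, ContDiff ℝ 2 (X j) ∧ Differentiable ℝ (w j)∧(∀ τ,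 ‖deriv (X j) τ‖ = 1)∧(∀ τ, ‖iteratedDeriv 2 (X j) τ‖*√Γ≤K) ∧ Tendsto (fun τ => ‖X j τ‖) (cocompact ℝ) atTop) ∧ (∀ j k, j ≠ k → ∀ τ σ, ρ*√Γ≤‖X j τ-X k σ‖) ∧ (∀ j τ σ, ρ*√Γ≤|τ-σ| → cg*ρ*√Γ≤‖X j τ-X j σ‖) ∧ (∀ j τ, cg*|τ-c j|≤Rw*√Γ+‖X j τ‖) ∧ (∀ j τ, w j τ = ⟪v (X j τ), deriv (X j) τ⟫_ℝ) ∧ (∀ j τ, ‖X j τ‖≤Rb*√(Γ*Real.log Γ) → v (X j τ) = w j τ•deriv (X j) τ) ∧ (∀ j, ‖X j (c j)‖≤Rw*√Γ) ∧ (∀ j, |⟪deriv (X j) (c j), EuclideanSpace.single 2 1⟫_ℝ|≤1-θ₀) ∧ (θ₀≤|α| ∧ |α|≤θ₀⁻¹ ∧ ∀ j, θ₀≤|γ j| ∧ |γ j|≤θ₀⁻¹) ∧ (∀ j, w j (c j) = 0 ∧ (∀ τ, w j τ = 0 → τ = c j) ∧ 3/2+δ≤deriv (w j) (c j) ∧ deriv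 (w j) (c j)≤Λ) ∧ (∀ j, Differentiable ℝ (Aa j) ∧ (∀ τ, 0 < Aa j τ) ∧ 1≤KA*Aa j (c j) ∧ ∀ τ, ‖X j τ‖≤2*Rb*√(Γ*Real.log Γ) → Aa j τ = Aa j (c j)) ∧ (∀ j τ, Rw^2*Γ*Aa j τ≤KA*(Rw^2*Γ+‖X j τ‖^2)))) → ((∀ j τ σ, ‖deriv (X j) τ - deriv (X j) σ‖ ≤ Rb) ∧ (∀ j τ, |deriv (w j) τ| ≤ Λ) ∧ (∀ j τ, Λ⁻¹ ≤ Aa j τ)) → (∃ (m n : Fin N → EuclideanSpace ℝ (Fin 3)), ∀ (u:(Fin N → ℝ → EuclideanSpace ℝ (Fin 3)) → EuclideanSpace ℝ (Fin 3) → EuclideanSpace ℝ (Fin 3)) (v:EuclideanSpace ℝ (Fin 3) → EuclideanSpace ℝ (Fin 3)) (A:Fin N → (EuclideanSpace ℝ (Fin 3) →L[ℝ] EuclideanSpace ℝ (Fin 3))) (T:(Fin N → ℝ → EuclideanSpace ℝ (Fin 3)) → Fin N → ℝ → EuclideanSpace ℝ (Fin 3)), (∀ Z y, u Z y = ∑ k,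 (Γ*γ k/(4*Real.pi))•∫ σ:ℝ, ((‖y-Z k σ‖^2+Real.exp (-(1+Real.eulerMascheroniConstant-Real.log 2))*Aa k σ)^(3/2:ℝ))⁻¹•cross (deriv (Z k) σ) (y-Z k σ))→(∀ y, v y = u X y+(1/2:ℝ)•y-α•cross (EuclideanSpace.single 2 1) y)→(∀ j, A j = fderiv ℝ v (X j (c j)))→(∀ Z j τ, T Z j τ = (u Z (Z j τ)+(1/2:ℝ)•Z j τ-α•cross (EuclideanSpace.single 2 1) (Z j τ))-(⟪u Z (Z j τ)+(1/2:ℝ)•Z j τ-α•cross (EuclideanSpace.single 2 1) (Z j τ), deriv (Z j) τ⟫_ℝ/‖deriv (Z j) τ‖^2)•deriv (Z j) τ)→(∀ j, Orthonormal ℝ ![deriv (X j) (c j), m j, n j] ∧ ⟪A j (m j), m j⟫_ℝ+⟪A j (n j), n j⟫_ℝ < 0 ∧ ⟪A j (n j), m j⟫_ℝ * ⟪A j (m j), n j⟫_ℝ < ⟪A j (m j), m j⟫_ℝ * ⟪A j (n j), n j⟫_ℝ))) ↔ NormalBlockMatchedL :=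
  Iff.rfl

/-- **THE GLUE THEOREM OF THE SPLIT** `SkeletonJ1L ⇐ TangentSkeletonNearStraightL, Clause13NearStraightL, NormalBlockMatchedL`,
with the three children written out in route vocabulary exactly as filed (`--glue-by` target). [folklore] -/
theorem skeletonJ1L_of_subs :
    (open Literature.Analysis.FluidPDE in ∀ (N : ℕ) (δd ρd Λd Rwd θd mw : ℝ) (p t : Fin N → EuclideanSpace ℝ (Fin 3)) (γ : Fin N → ℝ) (α : ℝ) (s₀ : Fin N → ℝ), 0 < N → 0 < δd → 0 < ρd → 0 < Rwd → 0 < θd → 0 < mw → ((∀ j, ‖t j‖ = 1) ∧ (∀ j k, j ≠ k → ∀ τ σ : ℝ, ρd ≤ ‖(p j + τ • t j) - (p k + σ • t k)‖) ∧ (∀ j, |⟪t j, EuclideanSpace.single 2 1⟫_ℝ| ≤ 1 - θd) ∧ (θd ≤ |α| ∧ |α| ≤ θd⁻¹ ∧ ∀ j, θd ≤ |γ j| ∧ |γ j| ≤ θd⁻¹) ∧ (∀ j, ‖p j + s₀ j • t j‖ ≤ Rwd) ∧ (∀ W : Fin N → ℝ → ℝ, (∀ j s, W j s = ⟪(∑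 k ∈ Finset.univ.erase j, (γ k / (2 * Real.pi)) • ((‖(p j + s • t j - p k) - ⟪p j + s • t j - p k, t k⟫_ℝ • t k‖ ^ 2)⁻¹ • cross (t k) ((p j + s • t j - p k) - ⟪p j + s • t j - p k, t k⟫_ℝ • t k))) + (1 / 2 : ℝ) • (p j + s • t j) - α • cross (EuclideanSpace.single 2 1) (p j + s • t j), t j⟫_ℝ) → ∀ j, W j (s₀ j) = 0 ∧ (∀ s, mw * |s - s₀ j| ≤ |W j s|) ∧ 3 / 2 + δd ≤ deriv (W j) (s₀ j) ∧ (∀ s, |deriv (W j) s| ≤ Λd))) → (∀ j k, j ≠ k → |⟪t j, t k⟫_ℝ| ≤ 1 - θd) → ∃ (δ ρ K Λ Rw cg θ₀ KA Rb₁ : ℝ), 0 < δ ∧ 0 < ρ ∧ 0 < Rw ∧ 0 < cg ∧ 0 < θ₀ ∧ 0 < Rb₁ ∧ 2 * K * ρ ≤ 1 ∧ ∀ Rb : ℝ, 0 < Rb → Rb ≤ Rb₁ → ∃ Γ₂ : ℝ, ∀ Γ : ℝ, Γ₂ ≤ Γ → ∃ (X : Fin N → ℝ → EuclideanSpace ℝ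 (Fin 3)) (w : Fin N → ℝ → ℝ) (c : Fin N → ℝ) (Aa : Fin N → ℝ → ℝ), (∀ (u:(Fin N → ℝ → EuclideanSpace ℝ (Fin 3)) → EuclideanSpace ℝ (Fin 3) → EuclideanSpace ℝ (Fin 3)) (v:EuclideanSpace ℝ (Fin 3) → EuclideanSpace ℝ (Fin 3)) (A:Fin N → (EuclideanSpace ℝ (Fin 3) →L[ℝ] EuclideanSpace ℝ (Fin 3))) (T:(Fin N → ℝ → EuclideanSpace ℝ (Fin 3)) → Fin N → ℝ → EuclideanSpace ℝ (Fin 3)), (∀ Z y, u Z y = ∑ k, (Γ*γ k/(4*Real.pi))•∫ σ:ℝ, ((‖y-Z k σ‖^2+Real.exp (-(1+Real.eulerMascheroniConstant-Real.log 2))*Aa k σ)^(3/2:ℝ))⁻¹•cross (deriv (Z k) σ) (y-Z k σ))→(∀ y, v y = u X y+(1/2:ℝ)•y-α•cross (EuclideanSpace.single 2 1) y)→(∀ j, A j = fderiv ℝ v (X j (c j)))→(∀ Z j τ, T Z j τ = (u Z (Z j τ)+(1/2:ℝ)•Z j τ-α•cross (EuclideanSpace.single 2 1) (Z j τ))-(⟪u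 Z (Z j τ)+(1/2:ℝ)•Z j τ-α•cross (EuclideanSpace.single 2 1) (Z j τ), deriv (Z j) τ⟫_ℝ/‖deriv (Z j) τ‖^2)•deriv (Z j) τ)→(α ≠ 0 ∧ (∀ j, γ j ≠ 0) ∧ (∀ j, ContDiff ℝ 2 (X j) ∧ Differentiable ℝ (w j)∧(∀ τ, ‖deriv (X j) τ‖ = 1)∧(∀ τ, ‖iteratedDeriv 2 (X j) τ‖*√Γ≤K) ∧ Tendsto (fun τ => ‖X j τ‖) (cocompact ℝ) atTop) ∧ (∀ j k, j ≠ k → ∀ τ σ, ρ*√Γ≤‖X j τ-X k σ‖) ∧ (∀ j τ σ, ρ*√Γ≤|τ-σ| → cg*ρ*√Γ≤‖X j τ-X j σ‖) ∧ (∀ j τ, cg*|τ-c j|≤Rw*√Γ+‖X j τ‖) ∧ (∀ j τ, w j τ = ⟪v (X j τ), deriv (X j) τ⟫_ℝ) ∧ (∀ j τ, ‖X j τ‖≤Rb*√(Γ*Real.log Γ) → v (X j τ) = w j τ•deriv (X j) τ) ∧ (∀ j, ‖X j (c j)‖≤Rw*√Γ) ∧ (∀ j, |⟪deriv (X j) (c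 j), EuclideanSpace.single 2 1⟫_ℝ|≤1-θ₀) ∧ (θ₀≤|α| ∧ |α|≤θ₀⁻¹ ∧ ∀ j, θ₀≤|γ j| ∧ |γ j|≤θ₀⁻¹) ∧ (∀ j, w j (c j) = 0 ∧ (∀ τ, w j τ = 0 → τ = c j) ∧ 3/2+δ≤deriv (w j) (c j) ∧ deriv (w j) (c j)≤Λ) ∧ (∀ j, Differentiable ℝ (Aa j) ∧ (∀ τ, 0 < Aa j τ) ∧ 1≤KA*Aa j (c j) ∧ ∀ τ, ‖X j τ‖≤2*Rb*√(Γ*Real.log Γ) → Aa j τ = Aa j (c j)) ∧ (∀ j τ, Rw^2*Γ*Aa j τ≤KA*(Rw^2*Γ+‖X j τ‖^2)))) ∧ ((∀ j τ σ, ‖deriv (X j) τ - deriv (X j) σ‖ ≤ Rb) ∧ (∀ j τ, |deriv (w j) τ| ≤ Λ) ∧ (∀ j τ, Λ⁻¹ ≤ Aa j τ))) →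
    (open Literature.Analysis.FluidPDE in ∀ (N : ℕ) (δ ρ K Λ Rw cg θ₀ KA : ℝ), 0 < N → 0 < δ → 0 < ρ → 0 < Rw → 0 < cg → 0 < θ₀ → ∃ Rb₀ : ℝ, 0 < Rb₀ ∧ ∀ Rb : ℝ, 0 < Rb → Rb ≤ Rb₀ → ∃ (a b cnd Γ₀ : ℝ), 0 ≤ a ∧ 0 < cnd ∧ ∀ Γ : ℝ, Γ₀ ≤ Γ → ∀ (γ : Fin N → ℝ) (α : ℝ) (X : Fin N → ℝ → EuclideanSpace ℝ (Fin 3)) (w : Fin N → ℝ → ℝ) (c : Fin N → ℝ) (Aa : Fin N → ℝ → ℝ), (∀ (u:(Fin N → ℝ → EuclideanSpace ℝ (Fin 3)) → EuclideanSpace ℝ (Fin 3) → EuclideanSpace ℝ (Fin 3)) (v:EuclideanSpace ℝ (Fin 3) → EuclideanSpace ℝ (Fin 3)) (A:Fin N → (EuclideanSpace ℝ (Fin 3) →L[ℝ] EuclideanSpace ℝ (Fin 3))) (T:(Fin N → ℝ → EuclideanSpace ℝ (Fin 3)) → Fin N → ℝ → EuclideanSpace ℝ (Fin 3)), (∀ Z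 y, u Z y = ∑ k, (Γ*γ k/(4*Real.pi))•∫ σ:ℝ, ((‖y-Z k σ‖^2+Real.exp (-(1+Real.eulerMascheroniConstant-Real.log 2))*Aa k σ)^(3/2:ℝ))⁻¹•cross (deriv (Z k) σ) (y-Z k σ))→(∀ y, v y = u X y+(1/2:ℝ)•y-α•cross (EuclideanSpace.single 2 1) y)→(∀ j, A j = fderiv ℝ v (X j (c j)))→(∀ Z j τ, T Z j τ = (u Z (Z j τ)+(1/2:ℝ)•Z j τ-α•cross (EuclideanSpace.single 2 1) (Z j τ))-(⟪u Z (Z j τ)+(1/2:ℝ)•Z j τ-α•cross (EuclideanSpace.single 2 1) (Z j τ), deriv (Z j) τ⟫_ℝ/‖deriv (Z j) τ‖^2)•deriv (Z j) τ)→(α ≠ 0 ∧ (∀ j, γ j ≠ 0) ∧ (∀ j, ContDiff ℝ 2 (X j) ∧ Differentiable ℝ (w j)∧(∀ τ, ‖deriv (X j) τ‖ = 1)∧(∀ τ, ‖iteratedDeriv 2 (X j) τ‖*√Γ≤K) ∧ Tendsto (fun τ => ‖X j τ‖) (cocompact ℝ) atTop) ∧ (∀ j k, j ≠ k → ∀ τ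 σ, ρ*√Γ≤‖X j τ-X k σ‖) ∧ (∀ j τ σ, ρ*√Γ≤|τ-σ| → cg*ρ*√Γ≤‖X j τ-X j σ‖) ∧ (∀ j τ, cg*|τ-c j|≤Rw*√Γ+‖X j τ‖) ∧ (∀ j τ, w j τ = ⟪v (X j τ), deriv (X j) τ⟫_ℝ) ∧ (∀ j τ, ‖X j τ‖≤Rb*√(Γ*Real.log Γ) → v (X j τ) = w j τ•deriv (X j) τ) ∧ (∀ j, ‖X j (c j)‖≤Rw*√Γ) ∧ (∀ j, |⟪deriv (X j) (c j), EuclideanSpace.single 2 1⟫_ℝ|≤1-θ₀) ∧ (θ₀≤|α| ∧ |α|≤θ₀⁻¹ ∧ ∀ j, θ₀≤|γ j| ∧ |γ j|≤θ₀⁻¹) ∧ (∀ j, w j (c j) = 0 ∧ (∀ τ, w j τ = 0 → τ = c j) ∧ 3/2+δ≤deriv (w j) (c j) ∧ deriv (w j) (c j)≤Λ) ∧ (∀ j, Differentiable ℝ (Aa j) ∧ (∀ τ, 0 < Aa j τ) ∧ 1≤KA*Aa j (c j) ∧ ∀ τ, ‖X j τ‖≤2*Rb*√(Γ*Real.log Γ)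 → Aa j τ = Aa j (c j)) ∧ (∀ j τ, Rw^2*Γ*Aa j τ≤KA*(Rw^2*Γ+‖X j τ‖^2)))) → ((∀ j τ σ, ‖deriv (X j) τ - deriv (X j) σ‖ ≤ Rb) ∧ (∀ j τ, |deriv (w j) τ| ≤ Λ) ∧ (∀ j τ, Λ⁻¹ ≤ Aa j τ)) → (∀ (u:(Fin N → ℝ → EuclideanSpace ℝ (Fin 3)) → EuclideanSpace ℝ (Fin 3) → EuclideanSpace ℝ (Fin 3)) (v:EuclideanSpace ℝ (Fin 3) → EuclideanSpace ℝ (Fin 3)) (A:Fin N → (EuclideanSpace ℝ (Fin 3) →L[ℝ] EuclideanSpace ℝ (Fin 3))) (T:(Fin N → ℝ → EuclideanSpace ℝ (Fin 3)) → Fin N → ℝ → EuclideanSpace ℝ (Fin 3)), (∀ Z y, u Z y = ∑ k, (Γ*γ k/(4*Real.pi))•∫ σ:ℝ, ((‖y-Z k σ‖^2+Real.exp (-(1+Real.eulerMascheroniConstant-Real.log 2))*Aa k σ)^(3/2:ℝ))⁻¹•cross (deriv (Z k) σ) (y-Z k σ))→(∀ y, v y = u X y+(1/2:ℝ)•y-α•cross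 (EuclideanSpace.single 2 1) y)→(∀ j, A j = fderiv ℝ v (X j (c j)))→(∀ Z j τ, T Z j τ = (u Z (Z j τ)+(1/2:ℝ)•Z j τ-α•cross (EuclideanSpace.single 2 1) (Z j τ))-(⟪u Z (Z j τ)+(1/2:ℝ)•Z j τ-α•cross (EuclideanSpace.single 2 1) (Z j τ), deriv (Z j) τ⟫_ℝ/‖deriv (Z j) τ‖^2)•deriv (Z j) τ)→(∀ Y:Fin N → ℝ → EuclideanSpace ℝ (Fin 3), (∀ j, ContDiff ℝ 2 (Y j))→(∀ j τ, ⟪Y j τ, deriv (X j) τ⟫_ℝ = 0) → (∀ j τ, Rb*√(Γ*Real.log Γ) < ‖X j τ‖ → Y j τ = 0) → ∑ j, ⟪Y j (c j), cross (EuclideanSpace.single 2 1) (X j (c j))⟫_ℝ = 0 → (∀ j τ, ‖Y j τ‖+‖deriv (Y j) τ‖+‖iteratedDeriv 2 (Y j) τ‖≤(1+|τ-c j|)^b) → ∀ L:ℝ, (∀ j τ, ‖deriv (fun s:ℝ => T (fun k σ => X k σ+s•Y k σ) j τ) 0‖≤L*(1+|τ-c j|)^a) → ∀ j τ, ‖Y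 j τ‖≤cnd*L*(1+|τ-c j|)^b))) →
    (open Literature.Analysis.FluidPDE in ∀ (N : ℕ) (δ ρ K Λ Rw Rb cg θ₀ KA : ℝ), 0 < N → 0 < δ → 0 < ρ → 0 < Rw → 0 < Rb → 0 < cg → 0 < θ₀ → 2 * K * ρ ≤ 1 → ∃ Γ₀ : ℝ, ∀ Γ : ℝ, Γ₀ ≤ Γ → ∀ (γ : Fin N → ℝ) (α : ℝ) (X : Fin N → ℝ → EuclideanSpace ℝ (Fin 3)) (w : Fin N → ℝ → ℝ) (c : Fin N → ℝ) (Aa : Fin N → ℝ → ℝ), (∀ (u:(Fin N → ℝ → EuclideanSpace ℝ (Fin 3)) → EuclideanSpace ℝ (Fin 3) → EuclideanSpace ℝ (Fin 3)) (v:EuclideanSpace ℝ (Fin 3) → EuclideanSpace ℝ (Fin 3)) (A:Fin N → (EuclideanSpace ℝ (Fin 3) →L[ℝ] EuclideanSpace ℝ (Fin 3))) (T:(Fin N → ℝ → EuclideanSpace ℝ (Fin 3)) → Fin N → ℝ → EuclideanSpace ℝ (Fin 3)), (∀ Z y, u Z y = ∑ k, (Γ*γ k/(4*Real.pi))•∫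 σ:ℝ, ((‖y-Z k σ‖^2+Real.exp (-(1+Real.eulerMascheroniConstant-Real.log 2))*Aa k σ)^(3/2:ℝ))⁻¹•cross (deriv (Z k) σ) (y-Z k σ))→(∀ y, v y = u X y+(1/2:ℝ)•y-α•cross (EuclideanSpace.single 2 1) y)→(∀ j, A j = fderiv ℝ v (X j (c j)))→(∀ Z j τ, T Z j τ = (u Z (Z j τ)+(1/2:ℝ)•Z j τ-α•cross (EuclideanSpace.single 2 1) (Z j τ))-(⟪u Z (Z j τ)+(1/2:ℝ)•Z j τ-α•cross (EuclideanSpace.single 2 1) (Z j τ), deriv (Z j) τ⟫_ℝ/‖deriv (Z j) τ‖^2)•deriv (Z j) τ)→(α ≠ 0 ∧ (∀ j, γ j ≠ 0) ∧ (∀ j, ContDiff ℝ 2 (X j) ∧ Differentiable ℝ (w j)∧(∀ τ, ‖deriv (X j) τ‖ = 1)∧(∀ τ, ‖iteratedDeriv 2 (X j) τ‖*√Γ≤K) ∧ Tendsto (fun τ => ‖X j τ‖) (cocompact ℝ) atTop) ∧ (∀ j k, j ≠ k → ∀ τ σ, ρ*√Γ≤‖X j τ-X k σ‖) ∧ (∀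 j τ σ, ρ*√Γ≤|τ-σ| → cg*ρ*√Γ≤‖X j τ-X j σ‖) ∧ (∀ j τ, cg*|τ-c j|≤Rw*√Γ+‖X j τ‖) ∧ (∀ j τ, w j τ = ⟪v (X j τ), deriv (X j) τ⟫_ℝ) ∧ (∀ j τ, ‖X j τ‖≤Rb*√(Γ*Real.log Γ) → v (X j τ) = w j τ•deriv (X j) τ) ∧ (∀ j, ‖X j (c j)‖≤Rw*√Γ) ∧ (∀ j, |⟪deriv (X j) (c j), EuclideanSpace.single 2 1⟫_ℝ|≤1-θ₀) ∧ (θ₀≤|α| ∧ |α|≤θ₀⁻¹ ∧ ∀ j, θ₀≤|γ j| ∧ |γ j|≤θ₀⁻¹) ∧ (∀ j, w j (c j) = 0 ∧ (∀ τ, w j τ = 0 → τ = c j) ∧ 3/2+δ≤deriv (w j) (c j) ∧ deriv (w j) (c j)≤Λ) ∧ (∀ j, Differentiable ℝ (Aa j) ∧ (∀ τ, 0 < Aa j τ) ∧ 1≤KA*Aa j (c j) ∧ ∀ τ, ‖X j τ‖≤2*Rb*√(Γ*Real.log Γ) → Aa j τ = Aa j (c j)) ∧ (∀ j τ, Rw^2*Γ*Aa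 j τ≤KA*(Rw^2*Γ+‖X j τ‖^2)))) → ((∀ j τ σ, ‖deriv (X j) τ - deriv (X j) σ‖ ≤ Rb) ∧ (∀ j τ, |deriv (w j) τ| ≤ Λ) ∧ (∀ j τ, Λ⁻¹ ≤ Aa j τ)) → (∃ (m n : Fin N → EuclideanSpace ℝ (Fin 3)), ∀ (u:(Fin N → ℝ → EuclideanSpace ℝ (Fin 3)) → EuclideanSpace ℝ (Fin 3) → EuclideanSpace ℝ (Fin 3)) (v:EuclideanSpace ℝ (Fin 3) → EuclideanSpace ℝ (Fin 3)) (A:Fin N → (EuclideanSpace ℝ (Fin 3) →L[ℝ] EuclideanSpace ℝ (Fin 3))) (T:(Fin N → ℝ → EuclideanSpace ℝ (Fin 3)) → Fin N → ℝ → EuclideanSpace ℝ (Fin 3)), (∀ Z y, u Z y = ∑ k, (Γ*γ k/(4*Real.pi))•∫ σ:ℝ, ((‖y-Z k σ‖^2+Real.exp (-(1+Real.eulerMascheroniConstant-Real.log 2))*Aa k σ)^(3/2:ℝ))⁻¹•cross (deriv (Z k) σ) (y-Z k σ))→(∀ y, v y = u X y+(1/2:ℝ)•y-α•cross (EuclideanSpace.single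 2 1) y)→(∀ j, A j = fderiv ℝ v (X j (c j)))→(∀ Z j τ, T Z j τ = (u Z (Z j τ)+(1/2:ℝ)•Z j τ-α•cross (EuclideanSpace.single 2 1) (Z j τ))-(⟪u Z (Z j τ)+(1/2:ℝ)•Z j τ-α•cross (EuclideanSpace.single 2 1) (Z j τ), deriv (Z j) τ⟫_ℝ/‖deriv (Z j) τ‖^2)•deriv (Z j) τ)→(∀ j, Orthonormal ℝ ![deriv (X j) (c j), m j, n j] ∧ ⟪A j (m j), m j⟫_ℝ+⟪A j (n j), n j⟫_ℝ < 0 ∧ ⟪A j (n j), m j⟫_ℝ * ⟪A j (m j), n j⟫_ℝ < ⟪A j (m j), m j⟫_ℝ * ⟪A j (n j), n j⟫_ℝ))) →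
    SkeletonJ1L :=
  fun h2 h3 h4 => skeletonJ1L_of_pieces (tangentSkeletonNearStraightL_iff.mp h2) (clause13NearStraightL_iff.mp h3)
    (normalBlockMatchedL_iff.mp h4)

end SplitA1L

end Summit.NavierStokesRegularity.NavierStokesRegularity.Cruxes.SelectionBoxRJ.RetypeKitA1L
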